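import Mathlib.RingTheory.Etale.Pi
import Mathlib.RingTheory.FinitePresentation
import Mathlib.RingTheory.FiniteStability
import Mathlib.RingTheory.Localization.Basic
import Mathlib.RingTheory.Localization.LocalizationLocalization
import Mathlib.RingTheory.Localization.Integer
import Mathlib.Algebra.Colimit.DirectLimit
import Literature.RingTheory.Etale.WeaklyEtaleDirectLimit
import HarnessLib

/-!
# Ind-étale algebras through the factorization criterion

An `A`-algebra `C` is *ind-étale* if it is a filtered colimit of étale `A`-algebras
(Bhatt–Scholze, *The pro-étale topology for schemes*, §2.2; Stacks Project, Tag 097I). Because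
étale algebras are finitely presented, i.e. compact objects of the category of `A`-algebras, this is
equivalent to the **factorization criterion**

> `FactorsEtale A C`: every `A`-algebra map `P → C` from a finitely presented `A`-algebra `P`
> factors through an étale `A`-algebra,

which is the form in which the closure properties of ind-étale algebras (Stacks Project, Tags
097J–097M, via Algebra Tags 0BSH–0BSJ, 08HS) are proved here. This file provides:

* `FactorsEtale` and its elementary closure properties: `of_etale`, `of_equiv`, `pi`
  (finite products), `restrict` (an étale `A`-algebra `B'` under `C`: `FactorsEtale B' C`),
  `of_etale_left` (`FactorsEtale B' C` over an étale `B'` gives `FactorsEtale A C`);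
* `exists_factor_of_finitePresentation` — **finitely presented algebras are compact**: an
  `A`-algebra map from a finitely presented `A`-algebra to a directed colimit `colim Gᵢ` factors
  through some `Gᵢ` (also a ring version `exists_ringHom_factor_of_finitePresentation` for
  finitely presented `ℤ`-algebras);
* `FactorsEtale.directLimit` — a directed colimit of algebras satisfying the criterion satisfies
  it (Tag 097L / 0BSJ); in particular a directed colimit of étale algebras does
  (`FactorsEtale.directLimit_of_etale`);
* `FactorsEtale.of_isLocalization` — a localization `S⁻¹C` satisfies the criterion over `C`
  (localizations are ind-Zariski, Tag 096N ff.);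
* `baseChangeDirectLimitEquiv` — **tensor products commute with directed colimits**,
  `M ⊗_S colimᵢ Hᵢ ≅ colimᵢ (M ⊗_S Hᵢ)` as `M`-algebras (Tag 00DD), and `iciEquiv` — the cofinal
  subsystem `(Gⱼ)_{j ≥ i}` (as `Gᵢ`-algebras) has the same colimit;
* `FactorsEtale.of_etale_over_directLimit` — **an étale algebra over a directed colimit of étale
  algebras is ind-étale** (Tag 0BSI: Noetherian model of the étale algebra over a finitely
  generated subring, Mathlib `Algebra.Etale.exists_subalgebra_fg` = Tag 00U2 (8), compactness, and
  the two isomorphisms above), whence `FactorsEtale.trans_directLimit` — transitivity of the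
  criterion through an explicitly presented middle term (Tag 097K).

The equivalence of the criterion with directed-colimit presentations (and the resulting general
transitivity and base change) is in `IndEtalePresentation.lean`.

## References

* The Stacks Project, Tags 097I–097N (ind-étale algebra), 00U2 (8) and 0BSH–0BSJ, 08HS
  (colimits and étale algebras). [StacksProject]
* B. Bhatt, P. Scholze, *The pro-étale topology for schemes*, Astérisque 369 (2015), §2.2–2.3.
  [BhattScholze2015]

## Design notes

* Everything lives in one universe `u` (rings of `Scheme.{u}` downstream); the criterion
  quantifies over finitely presented `P : Type u`.
* Directed colimits are Mathlib's `DirectLimit G f` of a `DirectedSystem` of `A`-algebra maps over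
  a nonempty directed preorder, as in `WeaklyEtaleDirectLimit.lean` (whose `exists_of_eq_family`
  is reused).
* Mathlib searched: `Algebra.Etale` (comp, baseChange, of_restrictScalars, Pi, Localization.Away),
  `Algebra.FinitePresentation` (out, equiv, trans, baseChange), `IsLocalization.liftAlgHom`,
  `isLocalization_of_submonoid_le`; no ind-étale notion and no compactness statement for
  finitely presented algebras with respect to `DirectLimit`. Nothing restated.
-/

universe u

namespace Literature.RingTheory.Etale

open TensorProduct

/-! ### The factorization criterion -/

/-- **Factorization criterion for ind-étale algebras**: every `A`-algebra map from a finitely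
presented `A`-algebra `P` to `C` factors through an étale `A`-algebra. For an `A`-algebra this is
equivalent to being a filtered (directed) colimit of étale `A`-algebras, i.e. to being ind-étale
(Bhatt–Scholze: "the category of ind-étale algebras is equivalent to the ind-category of étale
algebras by finite presentation constraints"). [cite: StacksProject, Tag 097I] -/
def FactorsEtale (A C : Type u) [CommRing A] [CommRing C] [Algebra A C] : Prop :=
  ∀ (P : Type u) [CommRing P] [Algebra A P] [Algebra.FinitePresentation A P] (φ : P →ₐ[A] C),
    ∃ (B : Type u) (_ : CommRing B) (_ : Algebra A B) (_ : Algebra.Etale A B)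
      (α : P →ₐ[A] B) (β : B →ₐ[A] C), β.comp α = φ

namespace FactorsEtale

variable {A : Type u} [CommRing A]

/-- An étale algebra satisfies the factorization criterion (factor through itself). [folklore] -/
theorem of_etale (C : Type u) [CommRing C] [Algebra A C] [Algebra.Etale A C] : FactorsEtale A C :=
  fun _ _ _ _ φ => ⟨C, inferInstance, inferInstance, inferInstance, φ, AlgHom.id A C, AlgHom.id_comp φ⟩

/-- The factorization criterion is transported along `A`-algebra isomorphisms. [folklore] -/
theorem of_equiv {C C' : Type u} [CommRing C] [Algebra A C] [CommRing C'] [Algebra A C']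
    (h : FactorsEtale A C) (e : C ≃ₐ[A] C') : FactorsEtale A C' := by
  intro P _ _ _ φ
  obtain ⟨B, _, _, _, α, β, hβ⟩ := h P (e.symm.toAlgHom.comp φ)
  refine ⟨B, inferInstance, inferInstance, inferInstance, α, e.toAlgHom.comp β, ?_⟩
  rw [AlgHom.comp_assoc, hβ]
  ext p
  simp

/-- A map into an algebra satisfying the criterion, precomposed with a map from a finitely
presented algebra, factors through an étale algebra (restatement for maps `P → C' → C`).
[folklore] -/
theorem comp {C : Type u} [CommRing C] [Algebra A C] (h : FactorsEtale A C)
    {P : Type u} [CommRing P] [Algebra A P] [Algebra.FinitePresentation A P] (φ : P →ₐ[A] C) :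
    ∃ (B : Type u) (_ : CommRing B) (_ : Algebra A B) (_ : Algebra.Etale A B)
      (α : P →ₐ[A] B) (β : B →ₐ[A] C), β.comp α = φ :=
  h P φ

/-- **Finite products**: if every `Cᵢ` (finitely many) satisfies the factorization criterion, so
does `Π Cᵢ` (factor componentwise and use that a finite product of étale algebras is étale).
[cite: StacksProject, Tag 097I] -/
theorem pi {ι : Type u} [Finite ι] (C : ι → Type u) [∀ i, CommRing (C i)] [∀ i, Algebra A (C i)]
    (h : ∀ i, FactorsEtale A (C i)) : FactorsEtale A (∀ i, C i) := by
  intro P _ _ _ φ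
  have hc : ∀ i, ∃ (B : Type u) (_ : CommRing B) (_ : Algebra A B) (_ : Algebra.Etale A B)
      (α : P →ₐ[A] B) (β : B →ₐ[A] C i), β.comp α = (Pi.evalAlgHom A C i).comp φ :=
    fun i => h i P _
  choose B iB aB eB α β hαβ using hc
  refine ⟨∀ i, B i, inferInstance, inferInstance, inferInstance, AlgHom.pi α,
    AlgHom.pi (fun i => (β i).comp (Pi.evalAlgHom A B i)), ?_⟩
  ext p i
  have := congrArg (fun ψ : P →ₐ[A] C i => ψ p) (hαβ i)
  simpa using this

/-- **Restriction to an étale subbase**: if `C` satisfies the criterion over `A` and `B'` is an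
étale `A`-algebra over which `C` is an algebra, then `C` satisfies the criterion over `B'` (a
finitely presented `B'`-algebra is finitely presented over `A`; the étale `A`-algebra through which
the map factors becomes an étale `B'`-algebra, Mathlib `Algebra.Etale.of_restrictScalars`).
[cite: StacksProject, Tag 097M] -/
theorem restrict {C : Type u} [CommRing C] [Algebra A C] (B' : Type u) [CommRing B'] [Algebra A B']
    [Algebra B' C] [IsScalarTower A B' C] [Algebra.Etale A B'] (h : FactorsEtale A C) :
    FactorsEtale B' C := by
  intro P _ _ _ φ
  letI : Algebra A P := ((algebraMap B' P).comp (algebraMap A B')).toAlgebra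
  haveI : IsScalarTower A B' P := IsScalarTower.of_algebraMap_eq (fun _ => rfl)
  haveI : Algebra.FinitePresentation A P := Algebra.FinitePresentation.trans A B' P
  obtain ⟨B, _, _, _, α, β, hαβ⟩ := h P (φ.restrictScalars A)
  -- `B` as a `B'`-algebra through `α`
  letI : Algebra B' B := (α.toRingHom.comp (algebraMap B' P)).toAlgebra
  haveI : IsScalarTower A B' B := IsScalarTower.of_algebraMap_eq (fun a => by
    change algebraMap A B a = α (algebraMap B' P (algebraMap A B' a))
    rw [← IsScalarTower.algebraMap_apply, AlgHom.commutes])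
  haveI : Algebra.Etale B' B := Algebra.Etale.of_restrictScalars A B' B
  let α' : P →ₐ[B'] B := { α.toRingHom with commutes' := fun _ => rfl }
  have hβ : ∀ b : B', β (algebraMap B' B b) = algebraMap B' C b := fun b => by
    change β (α (algebraMap B' P b)) = _
    have := congrArg (fun ψ : P →ₐ[A] C => ψ (algebraMap B' P b)) hαβ
    simpa using this
  let β' : B →ₐ[B'] C := { β.toRingHom with commutes' := hβ }
  refine ⟨B, inferInstance, inferInstance, inferInstance, α', β', ?_⟩
  ext p
  have := congrArg (fun ψ : P →ₐ[A] C => ψ p) hαβ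
  exact this

/-- **Descent along an étale base**: if `C` satisfies the criterion over an étale `A`-algebra
`B'`, it satisfies it over `A` (base-change the finitely presented `A`-algebra to `B'`; an étale
`B'`-algebra is étale over `A`). [cite: StacksProject, Tag 097K] -/
theorem of_etale_left {C : Type u} [CommRing C] [Algebra A C] (B' : Type u) [CommRing B']
    [Algebra A B'] [Algebra B' C] [IsScalarTower A B' C] [Algebra.Etale A B']
    (h : FactorsEtale B' C) : FactorsEtale A C := by
  intro P _ _ _ φ
  -- the base change `B' ⊗ P → C`
  let φ' : B' ⊗[A] P →ₐ[B'] C :=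
    Algebra.TensorProduct.lift (Algebra.ofId B' C) φ (fun _ _ => Commute.all _ _)
  obtain ⟨B, _, _, _, α, β, hαβ⟩ := h (B' ⊗[A] P) φ'
  letI : Algebra A B := ((algebraMap B' B).comp (algebraMap A B')).toAlgebra
  haveI : IsScalarTower A B' B := IsScalarTower.of_algebraMap_eq (fun _ => rfl)
  haveI : Algebra.Etale A B := Algebra.Etale.comp A B' B
  refine ⟨B, inferInstance, inferInstance, inferInstance,
    (α.restrictScalars A).comp Algebra.TensorProduct.includeRight, β.restrictScalars A, ?_⟩
  ext p
  have := congrArg (fun ψ : B' ⊗[A] P →ₐ[B'] C => ψ (1 ⊗ₜ p)) hαβ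
  simpa [φ'] using this

end FactorsEtale

/-! ### Maps out of quotients -/

section Quot

/-- An `A`-algebra map out of a quotient: if `π : M → P` is surjective and `θ : M → Q` kills
`ker π`, the induced `P → Q`. [folklore] -/
noncomputable def algHomOfSurjective {A : Type*} [CommRing A] {M P Q : Type*} [CommRing M]
    [Algebra A M] [CommRing P] [Algebra A P] [CommRing Q] [Algebra A Q] (π : M →ₐ[A] P) (hπ : Function.Surjective π)
    (θ : M →ₐ[A] Q) (hθ : ∀ m, π m = 0 → θ m = 0) : P →ₐ[A] Q :=
  (Ideal.Quotient.liftₐ (RingHom.ker π) θ (fun m hm => hθ m (by simpa using hm))).comp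
    ((Ideal.quotientKerAlgEquivOfSurjective hπ).symm : P →ₐ[A] M ⧸ RingHom.ker π)

/-- The defining property of `algHomOfSurjective`. [folklore] -/
theorem algHomOfSurjective_comp {A : Type*} [CommRing A] {M P Q : Type*} [CommRing M]
    [Algebra A M] [CommRing P] [Algebra A P] [CommRing Q] [Algebra A Q] (π : M →ₐ[A] P) (hπ : Function.Surjective π)
    (θ : M →ₐ[A] Q) (hθ : ∀ m, π m = 0 → θ m = 0) :
    (algHomOfSurjective π hπ θ hθ).comp π = θ := by
  refine AlgHom.ext fun m => ?_
  have hm : (Ideal.quotientKerAlgEquivOfSurjective hπ).symm (π m) =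
      Ideal.Quotient.mk (RingHom.ker π) m := by
    rw [AlgEquiv.symm_apply_eq]
    exact (Ideal.quotientKerAlgEquivOfSurjective_apply hπ m).symm
  unfold algHomOfSurjective
  rw [AlgHom.comp_apply, AlgHom.comp_apply, AlgEquiv.coe_toAlgHom, hm, Ideal.Quotient.liftₐ_apply,
    Ideal.Quotient.lift_mk]
  rfl

end Quot

/-! ### Finitely presented algebras are compact for directed colimits -/

section Compact

variable {A : Type u} [CommRing A] {ι : Type u} [Preorder ι] [Nonempty ι] [IsDirectedOrder ι]
  {G : ι → Type u} [∀ i, CommRing (G i)] [∀ i, Algebra A (G i)]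
  (f : ∀ i j, i ≤ j → G i →ₐ[A] G j) [DirectedSystem G (f · · ·)]

/-- **Finitely presented algebras are compact** (for directed colimits of algebras): an
`A`-algebra map from a finitely presented `A`-algebra `P` to `colim Gᵢ` factors through some `Gᵢ`
(the images of finitely many generators come from a common `Gᵢ`, the finitely many relations hold
in some later `Gⱼ`). [cite: StacksProject, Tag 00QO] -/
theorem exists_factor_of_finitePresentation (P : Type u) [CommRing P] [Algebra A P]
    [Algebra.FinitePresentation A P] (φ : P →ₐ[A] DirectLimit G f) :
    ∃ (j : ι) (φ₀ : P →ₐ[A] G j), (DirectLimit.Algebra.of G f j).comp φ₀ = φ := by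
  classical
  obtain ⟨n, π, hπ, hker⟩ := Algebra.FinitePresentation.out (R := A) (A := P)
  obtain ⟨s, hs⟩ := hker
  -- generators from a common stage
  obtain ⟨i, z, hz⟩ := exists_of_eq_family f (fun k : Fin n => φ (π (MvPolynomial.X k)))
  let ψ : MvPolynomial (Fin n) A →ₐ[A] G i := MvPolynomial.aeval z
  have hψ : (DirectLimit.Algebra.of G f i).comp ψ = φ.comp π := by
    refine MvPolynomial.algHom_ext fun k => ?_
    simp [ψ, hz k]
  -- every relation dies at some stage
  have hrel : ∀ g ∈ s, ∃ j, ∃ hij : i ≤ j, f i j hij (ψ g) = 0 := by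
    intro g hg
    have hg0 : π g = 0 := by
      have : g ∈ RingHom.ker π.toRingHom := hs ▸ Ideal.subset_span hg
      exact this
    have h0 : DirectLimit.Algebra.of G f i (ψ g) = 0 := by
      have := congrArg (fun χ : MvPolynomial (Fin n) A →ₐ[A] DirectLimit G f => χ g) hψ
      simp only [AlgHom.comp_apply] at this
      rw [this, hg0, map_zero]
    rw [DirectLimit.Algebra.of_apply] at h0
    obtain ⟨j, hij, hj⟩ := (DirectLimit.exists_eq_zero _).1 h0
    exact ⟨j, hij, hj⟩
  choose! jj hjj hfj using hrel
  obtain ⟨j, hj⟩ := Finset.exists_le (insert i (s.image jj))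
  have hij : i ≤ j := hj i (Finset.mem_insert_self _ _)
  have hjj' : ∀ g ∈ s, jj g ≤ j := fun g hg =>
    hj _ (Finset.mem_insert_of_mem (Finset.mem_image_of_mem jj hg))
  -- the map to `G j` kills the relations
  let θ : MvPolynomial (Fin n) A →ₐ[A] G j := (f i j hij).comp ψ
  have hθ : ∀ m, π m = 0 → θ m = 0 := by
    intro m hm
    have hm' : m ∈ Ideal.span (s : Set (MvPolynomial (Fin n) A)) := by
      rw [hs]; exact hm
    refine Submodule.span_induction (p := fun m _ => θ m = 0) ?_ (map_zero θ) ?_ ?_ hm'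
    · intro g hg
      change f i j hij (ψ g) = 0
      have h1 : f i j hij (ψ g) = f (jj g) j (hjj' g hg) (f i (jj g) (hjj g hg) (ψ g)) :=
        (DirectedSystem.map_map (f := (f · · ·)) (hjj g hg) (hjj' g hg) (ψ g)).symm
      rw [h1, hfj g hg, map_zero]
    · intro x y _ _ hx hy
      rw [map_add, hx, hy, add_zero]
    · intro a x _ hx
      rw [smul_eq_mul, map_mul, hx, mul_zero]
  refine ⟨j, algHomOfSurjective π hπ θ hθ, ?_⟩
  -- compare after the surjection `π`
  have key : ((DirectLimit.Algebra.of G f j).comp (algHomOfSurjective π hπ θ hθ)).comp π =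
      φ.comp π := by
    rw [AlgHom.comp_assoc, algHomOfSurjective_comp, ← hψ]
    refine AlgHom.ext fun m => ?_
    change DirectLimit.Algebra.of G f j (f i j hij (ψ m)) = DirectLimit.Algebra.of G f i (ψ m)
    rw [DirectLimit.Algebra.of_f]
  refine AlgHom.ext fun p => ?_
  obtain ⟨m, rfl⟩ := hπ p
  exact congrArg (fun χ : MvPolynomial (Fin n) A →ₐ[A] DirectLimit G f => χ m) key

/-- **A directed colimit of algebras satisfying the factorization criterion satisfies it**
(compactness of finitely presented algebras, then factor inside the stage reached).
[cite: StacksProject, Tag 097L] -/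
theorem FactorsEtale.directLimit (h : ∀ i, FactorsEtale A (G i)) :
    FactorsEtale A (DirectLimit G f) := by
  intro P _ _ _ φ
  obtain ⟨j, φ₀, hφ₀⟩ := exists_factor_of_finitePresentation f P φ
  obtain ⟨B, _, _, _, α, β, hαβ⟩ := h j P φ₀
  exact ⟨B, inferInstance, inferInstance, inferInstance, α, (DirectLimit.Algebra.of G f j).comp β,
    by rw [AlgHom.comp_assoc, hαβ, hφ₀]⟩

/-- **A directed colimit of étale algebras satisfies the factorization criterion** (it is the
model case of an ind-étale algebra). [cite: StacksProject, Tag 097I] -/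
theorem FactorsEtale.directLimit_of_etale [∀ i, Algebra.Etale A (G i)] :
    FactorsEtale A (DirectLimit G f) :=
  FactorsEtale.directLimit f fun i => FactorsEtale.of_etale (G i)

end Compact

/-! ### Localizations -/

section Localization

variable {C : Type u} [CommRing C]

/-- **A localization satisfies the factorization criterion over its base** (`C → S⁻¹C` is
ind-Zariski: a map from a finitely presented `C`-algebra to `S⁻¹C` factors through a principal
localization `C[1/t]`, `t ∈ S`, which is étale over `C`). [cite: StacksProject, Tag 096N] -/
theorem FactorsEtale.of_isLocalization (S : Submonoid C) (C' : Type u) [CommRing C'] [Algebra C C']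
    [IsLocalization S C'] : FactorsEtale C C' := by
  classical
  intro P _ _ _ φ
  obtain ⟨n, π, hπ, hker⟩ := Algebra.FinitePresentation.out (R := C) (A := P)
  obtain ⟨rel, hrel⟩ := hker
  -- common denominator `s ∈ S` for the images of the generators
  obtain ⟨s, hs⟩ := IsLocalization.exist_integer_multiples_of_finite S
    (fun k : Fin n => φ (π (MvPolynomial.X k)))
  choose c hc using hs
  -- `ψ : C[X] → C[1/s]`, `Xₖ ↦ cₖ / s`
  let Cs : Type u := Localization.Away s.1
  let ψ : MvPolynomial (Fin n) C →ₐ[C] Cs :=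
    MvPolynomial.aeval fun k => IsLocalization.mk' Cs (c k) (⟨s.1, Submonoid.mem_powers _⟩ :
      Submonoid.powers s.1)
  have hsu : ∀ y : Submonoid.powers s.1, IsUnit (algebraMap C C' y) := by
    rintro ⟨y, k, rfl⟩
    rw [map_pow]
    exact (IsLocalization.map_units C' s).pow k
  let ρ : Cs →ₐ[C] C' := IsLocalization.liftAlgHom (M := Submonoid.powers s.1)
    (f := Algebra.ofId C C') hsu
  have hρψ : ρ.comp ψ = φ.comp π := by
    refine MvPolynomial.algHom_ext fun k => ?_
    simp only [AlgHom.comp_apply, MvPolynomial.aeval_X, ψ, ρ, IsLocalization.coe_liftAlgHom]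
    rw [IsLocalization.lift_mk'_spec]
    simpa [Algebra.ofId_apply, Algebra.smul_def] using hc k
  -- `C'` is a localization of `C[1/s]`
  letI : Algebra Cs C' := ρ.toRingHom.toAlgebra
  haveI : IsScalarTower C Cs C' := IsScalarTower.of_algebraMap_eq fun x => (ρ.commutes x).symm
  haveI : IsLocalization (S.map (algebraMap C Cs)) C' :=
    IsLocalization.isLocalization_of_submonoid_le Cs C' (Submonoid.powers s.1) S
      (Submonoid.powers_le.2 s.2)
  -- each relation dies after multiplying by some `u ∈ S`
  have hdie : ∀ g ∈ rel, ∃ u : S, algebraMap C Cs u * ψ g = 0 := by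
    intro g hg
    have hg0 : π g = 0 := by
      have : g ∈ RingHom.ker π.toRingHom := hrel ▸ Ideal.subset_span hg
      exact this
    have h0 : algebraMap Cs C' (ψ g) = 0 := by
      change ρ (ψ g) = 0
      have := congrArg (fun χ : MvPolynomial (Fin n) C →ₐ[C] C' => χ g) hρψ
      simp only [AlgHom.comp_apply] at this
      rw [this, hg0, map_zero]
    obtain ⟨⟨m, hm⟩, hm0⟩ := (IsLocalization.map_eq_zero_iff (S.map (algebraMap C Cs)) C' _).1 h0
    obtain ⟨u, hu, rfl⟩ := Submonoid.mem_map.1 hm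
    exact ⟨⟨u, hu⟩, hm0⟩
  choose! uu huu using hdie
  -- `t = s · ∏ u_g ∈ S`; the relations vanish in `C[1/t]`
  let t : S := s * ∏ g ∈ rel.attach, uu g.1
  let Ct : Type u := Localization.Away (t : C)
  have hst : IsUnit (algebraMap C Ct s) := by
    have ht : IsUnit (algebraMap C Ct t) := IsLocalization.Away.algebraMap_isUnit (t : C)
    simp only [t, Submonoid.coe_mul, map_mul] at ht
    exact isUnit_of_mul_isUnit_left ht
  have hsu' : ∀ y : Submonoid.powers s.1, IsUnit (algebraMap C Ct y) := by
    rintro ⟨y, k, rfl⟩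
    rw [map_pow]
    exact hst.pow k
  let σ : Cs →ₐ[C] Ct := IsLocalization.liftAlgHom (M := Submonoid.powers s.1)
    (f := Algebra.ofId C Ct) hsu'
  have hut : ∀ g ∈ rel, IsUnit (algebraMap C Ct (uu g)) := by
    intro g hg
    have ht : IsUnit (algebraMap C Ct t) := IsLocalization.Away.algebraMap_isUnit (t : C)
    have hdvd : (uu g : C) ∣ (t : C) := by
      refine Dvd.intro_left ((s : C) * ∏ g' ∈ rel.attach.erase ⟨g, hg⟩, (uu g'.1 : C)) ?_
      simp only [t, Submonoid.coe_mul, Submonoid.coe_finsetProd]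
      rw [mul_assoc, Finset.prod_erase_mul _ _ (Finset.mem_attach _ ⟨g, hg⟩)]
    exact isUnit_of_dvd_unit (map_dvd _ hdvd) ht
  let θ : MvPolynomial (Fin n) C →ₐ[C] Ct := σ.comp ψ
  have hθ : ∀ m, π m = 0 → θ m = 0 := by
    intro m hm
    have hm' : m ∈ Ideal.span (rel : Set (MvPolynomial (Fin n) C)) := by rw [hrel]; exact hm
    refine Submodule.span_induction (p := fun m _ => θ m = 0) ?_ (map_zero θ) ?_ ?_ hm'
    · intro g hg
      change σ (ψ g) = 0
      have h1 : σ (algebraMap C Cs (uu g) * ψ g) = 0 := by rw [huu g hg, map_zero]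
      rw [map_mul, AlgHom.commutes] at h1
      exact (hut g hg).mul_right_eq_zero.1 h1
    · intro x y _ _ hx hy
      rw [map_add, hx, hy, add_zero]
    · intro a x _ hx
      rw [smul_eq_mul, map_mul, hx, mul_zero]
  -- `C[1/t] → C'`
  have htu : ∀ y : Submonoid.powers (t : C), IsUnit (algebraMap C C' y) := by
    rintro ⟨y, k, rfl⟩
    rw [map_pow]
    exact (IsLocalization.map_units C' t).pow k
  let β : Ct →ₐ[C] C' := IsLocalization.liftAlgHom (M := Submonoid.powers (t : C))
    (f := Algebra.ofId C C') htu
  have hβσ : β.comp σ = ρ := by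
    apply AlgHom.coe_ringHom_injective
    refine IsLocalization.ringHom_ext (Submonoid.powers s.1) ?_
    ext x
    simp
  haveI : Algebra.Etale C Ct := Algebra.Etale.of_isLocalizationAway (t : C)
  refine ⟨Ct, inferInstance, inferInstance, inferInstance, algHomOfSurjective π hπ θ hθ, β, ?_⟩
  have key : (β.comp (algHomOfSurjective π hπ θ hθ)).comp π = φ.comp π := by
    rw [AlgHom.comp_assoc, algHomOfSurjective_comp, ← hρψ, ← hβσ]
    rfl
  refine AlgHom.ext fun p => ?_
  obtain ⟨m, rfl⟩ := hπ p
  exact congrArg (fun χ : MvPolynomial (Fin n) C →ₐ[C] C' => χ m) key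

end Localization

/-! ### Tensor products commute with directed colimits of algebras -/

section BaseChangeDirectLimit

variable {S : Type u} [CommRing S] {ι : Type u} [Preorder ι] [Nonempty ι] [IsDirectedOrder ι]
  {H : ι → Type u} [∀ i, CommRing (H i)] [∀ i, Algebra S (H i)]
  (g : ∀ i j, i ≤ j → H i →ₐ[S] H j) [DirectedSystem H (g · · ·)]
  (M : Type u) [CommRing M] [Algebra S M]

/-- The transition maps `M ⊗ Hᵢ → M ⊗ Hⱼ` of the tensored directed system (as `M`-algebra maps).
[folklore] -/
noncomputable def bcTransition (i j : ι) (h : i ≤ j) : M ⊗[S] H i →ₐ[M] M ⊗[S] H j :=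
  Algebra.TensorProduct.map (AlgHom.id M M) (g i j h)

omit [Nonempty ι] [IsDirectedOrder ι] [DirectedSystem H (g · · ·)] in
/-- `bcTransition` on pure tensors. [folklore] -/
@[simp] theorem bcTransition_tmul (i j : ι) (h : i ≤ j) (m : M) (x : H i) :
    bcTransition g M i j h (m ⊗ₜ x) = m ⊗ₜ g i j h x := rfl

/-- The tensored system `(M ⊗ Hᵢ)ᵢ` is directed. [folklore] -/
instance bcTransition_directedSystem :
    DirectedSystem (fun i => M ⊗[S] H i) (bcTransition g M · · ·) where
  map_self := fun i x => by
    induction x using TensorProduct.induction_on with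
    | zero => exact map_zero _
    | tmul m x => rw [bcTransition_tmul, DirectedSystem.map_self' g]
    | add x y hx hy =>
      rw [map_add]
      exact congrArg₂ (· + ·) hx hy
  map_map := fun k j i hij hjk x => by
    induction x using TensorProduct.induction_on with
    | zero => simp only [map_zero]
    | tmul m x =>
      rw [bcTransition_tmul, bcTransition_tmul, bcTransition_tmul, DirectedSystem.map_map' g]
    | add x y hx hy =>
      rw [map_add, map_add, map_add]
      exact congrArg₂ (· + ·) hx hy

/-- The directed colimit `colimᵢ (M ⊗ Hᵢ)` (an `M`-algebra). [folklore] -/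
abbrev BaseChangeDirectLimit : Type u := DirectLimit (fun i => M ⊗[S] H i) (bcTransition g M)

/-- `colimᵢ (M ⊗ Hᵢ)` as an `S`-algebra (through `S → M`). [folklore] -/
noncomputable instance BaseChangeDirectLimit.algebraBase : Algebra S (BaseChangeDirectLimit g M) :=
  ((algebraMap M (BaseChangeDirectLimit g M)).comp (algebraMap S M)).toAlgebra

/-- `S → M → colimᵢ (M ⊗ Hᵢ)`. [folklore] -/
instance BaseChangeDirectLimit.isScalarTower : IsScalarTower S M (BaseChangeDirectLimit g M) :=
  IsScalarTower.of_algebraMap_eq fun _ => rfl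

/-- `Hᵢ → M ⊗ Hᵢ → colimⱼ (M ⊗ Hⱼ)`. [folklore] -/
noncomputable def toBaseChangeDirectLimit (i : ι) : H i →ₐ[S] BaseChangeDirectLimit g M :=
  ((DirectLimit.Algebra.of _ (bcTransition g M) i).restrictScalars S).comp
    (Algebra.TensorProduct.includeRight (R := S) (A := M) (B := H i))

/-- `toBaseChangeDirectLimit` unfolded. [folklore] -/
theorem toBaseChangeDirectLimit_apply (i : ι) (x : H i) :
    toBaseChangeDirectLimit g M i x = DirectLimit.Algebra.of _ (bcTransition g M) i (1 ⊗ₜ x) := rfl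

/-- `colimᵢ Hᵢ → colimᵢ (M ⊗ Hᵢ)`. [folklore] -/
noncomputable def ofDirectLimitToBaseChange : DirectLimit H g →ₐ[S] BaseChangeDirectLimit g M :=
  DirectLimit.Algebra.lift H g _ (toBaseChangeDirectLimit g M) fun i j hij x => by
    rw [toBaseChangeDirectLimit_apply, toBaseChangeDirectLimit_apply, ← bcTransition_tmul g M i j hij,
      DirectLimit.Algebra.of_f]

/-- **`M ⊗ colimᵢ Hᵢ → colimᵢ (M ⊗ Hᵢ)`**. [folklore] -/
noncomputable def baseChangeDirectLimitHom : M ⊗[S] DirectLimit H g →ₐ[M] BaseChangeDirectLimit g M :=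
  Algebra.TensorProduct.lift (Algebra.ofId M _) (ofDirectLimitToBaseChange g M) fun _ _ => Commute.all _ _

/-- **`colimᵢ (M ⊗ Hᵢ) → M ⊗ colimᵢ Hᵢ`**. [folklore] -/
noncomputable def baseChangeDirectLimitInv : BaseChangeDirectLimit g M →ₐ[M] M ⊗[S] DirectLimit H g :=
  DirectLimit.Algebra.lift _ (bcTransition g M) _
    (fun i => Algebra.TensorProduct.map (AlgHom.id M M) (DirectLimit.Algebra.of H g i))
    fun i j hij x => by
      induction x using TensorProduct.induction_on with
      | zero => simp only [map_zero]
      | tmul m x =>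
        rw [bcTransition_tmul, Algebra.TensorProduct.map_tmul, Algebra.TensorProduct.map_tmul,
          DirectLimit.Algebra.of_f]
      | add x y hx hy => rw [map_add, map_add, map_add, hx, hy]

/-- `M ⊗ colimᵢ Hᵢ → colimᵢ (M ⊗ Hᵢ)` on pure tensors. [folklore] -/
theorem baseChangeDirectLimitHom_tmul (m : M) (i : ι) (x : H i) :
    baseChangeDirectLimitHom g M (m ⊗ₜ DirectLimit.Algebra.of H g i x) =
      DirectLimit.Algebra.of _ (bcTransition g M) i (m ⊗ₜ x) := by
  rw [baseChangeDirectLimitHom, Algebra.TensorProduct.lift_tmul, ofDirectLimitToBaseChange,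
    DirectLimit.Algebra.lift_of, toBaseChangeDirectLimit_apply, Algebra.ofId_apply,
    ← (DirectLimit.Algebra.of _ (bcTransition g M) i).commutes m, ← map_mul,
    Algebra.TensorProduct.algebraMap_apply, Algebra.algebraMap_self, RingHom.id_apply,
    Algebra.TensorProduct.tmul_mul_tmul, one_mul, mul_one]

/-- `colimᵢ (M ⊗ Hᵢ) → M ⊗ colimᵢ Hᵢ` on the stages. [folklore] -/
theorem baseChangeDirectLimitInv_of (i : ι) (t : M ⊗[S] H i) :
    baseChangeDirectLimitInv g M (DirectLimit.Algebra.of _ (bcTransition g M) i t) =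
      Algebra.TensorProduct.map (AlgHom.id M M) (DirectLimit.Algebra.of H g i) t :=
  rfl

/-- **Tensor products commute with directed colimits**: `M ⊗_S colimᵢ Hᵢ ≅ colimᵢ (M ⊗_S Hᵢ)` as
`M`-algebras. [cite: StacksProject, Tag 00DD] -/
noncomputable def baseChangeDirectLimitEquiv : M ⊗[S] DirectLimit H g ≃ₐ[M] BaseChangeDirectLimit g M :=
  AlgEquiv.ofAlgHom (baseChangeDirectLimitHom g M) (baseChangeDirectLimitInv g M)
    (by
      refine DirectLimit.Algebra.hom_ext _ fun i => ?_
      refine Algebra.TensorProduct.ext' fun m x => ?_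
      rw [AlgHom.comp_apply, AlgHom.comp_apply, baseChangeDirectLimitInv_of,
        Algebra.TensorProduct.map_tmul, AlgHom.id_apply, baseChangeDirectLimitHom_tmul]
      rfl)
    (by
      refine Algebra.TensorProduct.ext' fun m y => ?_
      rw [AlgHom.comp_apply, AlgHom.id_apply]
      induction y using DirectLimit.induction with | _ i x
      change baseChangeDirectLimitInv g M (baseChangeDirectLimitHom g M (m ⊗ₜ DirectLimit.Algebra.of H g i x))
        = m ⊗ₜ DirectLimit.Algebra.of H g i x
      rw [baseChangeDirectLimitHom_tmul, baseChangeDirectLimitInv_of, Algebra.TensorProduct.map_tmul,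
        AlgHom.id_apply])

/-- `baseChangeDirectLimitEquiv` on pure tensors. [folklore] -/
theorem baseChangeDirectLimitEquiv_tmul (m : M) (i : ι) (x : H i) :
    baseChangeDirectLimitEquiv g M (m ⊗ₜ DirectLimit.Algebra.of H g i x) =
      DirectLimit.Algebra.of _ (bcTransition g M) i (m ⊗ₜ x) :=
  baseChangeDirectLimitHom_tmul g M m i x

end BaseChangeDirectLimit

/-! ### The cofinal subsystem `(Gⱼ)_{j ≥ i}` as `Gᵢ`-algebras -/

section Ici

variable {A : Type u} [CommRing A] {ι : Type u} [Preorder ι] [Nonempty ι] [IsDirectedOrder ι]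
  {G : ι → Type u} [∀ i, CommRing (G i)] [∀ i, Algebra A (G i)]
  (f : ∀ i j, i ≤ j → G i →ₐ[A] G j) [DirectedSystem G (f · · ·)]

/-- **Finitely presented rings are compact** (ring-map version, for finitely presented
`ℤ`-algebras): a ring map from a finitely presented `ℤ`-algebra to `colim Gᵢ` factors through some
`Gᵢ`. [cite: StacksProject, Tag 00QO] -/
theorem exists_ringHom_factor_of_finitePresentation (P : Type u) [CommRing P]
    (hP : ∃ (n : ℕ) (π : MvPolynomial (Fin n) ℤ →+* P), Function.Surjective π ∧ (RingHom.ker π).FG)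
    (φ : P →+* DirectLimit G f) :
    ∃ (j : ι) (φ₀ : P →+* G j), ∀ p, DirectLimit.Algebra.of G f j (φ₀ p) = φ p := by
  classical
  obtain ⟨n, π', hπ, hker⟩ := hP
  let π : MvPolynomial (Fin n) ℤ →ₐ[ℤ] P := π'.toIntAlgHom
  have hs' : RingHom.ker π.toRingHom = RingHom.ker π' := rfl
  obtain ⟨s, hs⟩ := hker
  rw [← hs'] at hs
  obtain ⟨i, z, hz⟩ := exists_of_eq_family f (fun k : Fin n => φ (π (MvPolynomial.X k)))
  let ψ : MvPolynomial (Fin n) ℤ →ₐ[ℤ] G i := MvPolynomial.aeval z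
  have hψ : ∀ q, DirectLimit.Algebra.of G f i (ψ q) = φ (π q) := by
    intro q
    have h : ((DirectLimit.Algebra.of G f i).toRingHom.comp ψ.toRingHom).toIntAlgHom =
        (φ.comp π.toRingHom).toIntAlgHom := by
      refine MvPolynomial.algHom_ext fun k => ?_
      change DirectLimit.Algebra.of G f i (MvPolynomial.aeval z (MvPolynomial.X k)) =
        φ (π (MvPolynomial.X k))
      rw [MvPolynomial.aeval_X]
      exact hz k
    exact congrArg (fun χ : MvPolynomial (Fin n) ℤ →ₐ[ℤ] DirectLimit G f => χ q) h
  have hrel : ∀ g ∈ s, ∃ j, ∃ hij : i ≤ j, f i j hij (ψ g) = 0 := by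
    intro g hg
    have hg0 : π g = 0 := by
      have : g ∈ RingHom.ker π.toRingHom := hs ▸ Ideal.subset_span hg
      exact this
    have h0 : DirectLimit.Algebra.of G f i (ψ g) = 0 := by rw [hψ, hg0, map_zero]
    rw [DirectLimit.Algebra.of_apply] at h0
    obtain ⟨j, hij, hj⟩ := (DirectLimit.exists_eq_zero _).1 h0
    exact ⟨j, hij, hj⟩
  choose! jj hjj hfj using hrel
  obtain ⟨j, hj⟩ := Finset.exists_le (insert i (s.image jj))
  have hij : i ≤ j := hj i (Finset.mem_insert_self _ _)
  have hjj' : ∀ g ∈ s, jj g ≤ j := fun g hg =>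
    hj _ (Finset.mem_insert_of_mem (Finset.mem_image_of_mem jj hg))
  let θ : MvPolynomial (Fin n) ℤ →ₐ[ℤ] G j := (f i j hij).toRingHom.toIntAlgHom.comp ψ
  have hθ : ∀ m, π m = 0 → θ m = 0 := by
    intro m hm
    have hm' : m ∈ Ideal.span (s : Set (MvPolynomial (Fin n) ℤ)) := by rw [hs]; exact hm
    refine Submodule.span_induction (p := fun m _ => θ m = 0) ?_ (map_zero θ) ?_ ?_ hm'
    · intro g hg
      change f i j hij (ψ g) = 0
      have h1 : f i j hij (ψ g) = f (jj g) j (hjj' g hg) (f i (jj g) (hjj g hg) (ψ g)) :=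
        (DirectedSystem.map_map (f := (f · · ·)) (hjj g hg) (hjj' g hg) (ψ g)).symm
      rw [h1, hfj g hg, map_zero]
    · intro x y _ _ hx hy
      rw [map_add, hx, hy, add_zero]
    · intro a x _ hx
      rw [smul_eq_mul, map_mul, hx, mul_zero]
  refine ⟨j, (algHomOfSurjective π hπ θ hθ).toRingHom, fun p => ?_⟩
  obtain ⟨m, rfl⟩ := hπ p
  have h1 : algHomOfSurjective π hπ θ hθ (π m) = θ m :=
    congrArg (fun χ : MvPolynomial (Fin n) ℤ →ₐ[ℤ] G j => χ m) (algHomOfSurjective_comp π hπ θ hθ)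
  change DirectLimit.Algebra.of G f j (algHomOfSurjective π hπ θ hθ (π m)) = φ (π m)
  rw [h1, ← hψ]
  exact DirectLimit.Algebra.of_f hij (ψ m)

/-- The stage `Gⱼ`, `j ≥ i`, as a `Gᵢ`-algebra through the transition map `Gᵢ → Gⱼ` (a type
synonym carrying the system `f`, which only enters through the instances). [folklore] -/
@[nolint unusedArguments]
def IciStage (_f : ∀ i j, i ≤ j → G i →ₐ[A] G j) (i : ι) (j : {j // i ≤ j}) : Type u := G j.1

namespace IciStage

variable (i : ι) (j : {j // i ≤ j})

/-- Ring structure of `Gⱼ`. [folklore] -/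
instance instCommRing : CommRing (IciStage f i j) := inferInstanceAs (CommRing (G j.1))

/-- `A`-algebra structure of `Gⱼ`. [folklore] -/
instance instAlgebraBase : Algebra A (IciStage f i j) := inferInstanceAs (Algebra A (G j.1))

/-- `Gⱼ` is a `Gᵢ`-algebra through `f i j`. [folklore] -/
noncomputable instance instAlgebra : Algebra (G i) (IciStage f i j) :=
  (f i j.1 j.2).toRingHom.toAlgebra

omit [Nonempty ι] [IsDirectedOrder ι] [DirectedSystem G (f · · ·)] in
/-- The structure map `Gᵢ → Gⱼ` is `f i j`. [folklore] -/
theorem algebraMap_apply (x : G i) : algebraMap (G i) (IciStage f i j) x = f i j.1 j.2 x := rfl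

/-- `A → Gᵢ → Gⱼ`. [folklore] -/
instance instIsScalarTower : IsScalarTower A (G i) (IciStage f i j) :=
  IsScalarTower.of_algebraMap_eq fun a => ((f i j.1 j.2).commutes a).symm

/-- `Gⱼ` is étale over `A` when the system is. [folklore] -/
instance instEtaleBase [∀ i, Algebra.Etale A (G i)] : Algebra.Etale A (IciStage f i j) :=
  inferInstanceAs (Algebra.Etale A (G j.1))

/-- A map between étale `A`-algebras is étale: `Gⱼ` is étale over `Gᵢ`.
[cite: StacksProject, Tag 00U7] -/
instance instEtale [∀ i, Algebra.Etale A (G i)] : Algebra.Etale (G i) (IciStage f i j) :=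
  Algebra.Etale.of_restrictScalars A (G i) (IciStage f i j)

end IciStage

/-- The transition maps of the cofinal subsystem `(Gⱼ)_{j ≥ i}` as `Gᵢ`-algebra maps.
[folklore] -/
def iciTransition (i : ι) (j k : {j // i ≤ j}) (h : j ≤ k) :
    IciStage f i j →ₐ[G i] IciStage f i k :=
  { (f j.1 k.1 h).toRingHom with
    commutes' := fun x => DirectedSystem.map_map' f j.2 h x }

omit [Nonempty ι] [IsDirectedOrder ι] in
/-- `iciTransition` is `f j k`. [folklore] -/
theorem iciTransition_apply (i : ι) (j k : {j // i ≤ j}) (h : j ≤ k) (x : G j.1) :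
    iciTransition f i j k h x = f j.1 k.1 h x := rfl

/-- The cofinal subsystem is directed. [folklore] -/
instance iciTransition_directedSystem (i : ι) :
    DirectedSystem (IciStage f i) (iciTransition f i · · ·) where
  map_self := fun _ x => DirectedSystem.map_self' f x
  map_map := fun _ _ _ h h' x => DirectedSystem.map_map' f h h' x

/-- `{j // i ≤ j}` is nonempty. [folklore] -/
instance nonempty_Ici (i : ι) : Nonempty {j // i ≤ j} := ⟨⟨i, le_rfl⟩⟩

/-- `{j // i ≤ j}` is directed. [folklore] -/
instance isDirectedOrder_Ici (i : ι) : IsDirectedOrder {j // i ≤ j} :=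
  ⟨fun a b => by
    obtain ⟨c, hac, hbc⟩ := exists_ge_ge a.1 b.1
    exact ⟨⟨c, a.2.trans hac⟩, hac, hbc⟩⟩

/-- The colimit of the cofinal subsystem `colim_{j ≥ i} Gⱼ` (a `Gᵢ`-algebra). [folklore] -/
abbrev IciDirectLimit (i : ι) : Type u := DirectLimit (IciStage f i) (iciTransition f i)

/-- `colim_{j ≥ i} Gⱼ` as an `A`-algebra (through `A → Gᵢ`). [folklore] -/
noncomputable instance IciDirectLimit.algebraBase (i : ι) : Algebra A (IciDirectLimit f i) :=
  ((algebraMap (G i) (IciDirectLimit f i)).comp (algebraMap A (G i))).toAlgebra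

/-- `A → Gᵢ → colim_{j ≥ i} Gⱼ`. [folklore] -/
instance IciDirectLimit.isScalarTower (i : ι) : IsScalarTower A (G i) (IciDirectLimit f i) :=
  IsScalarTower.of_algebraMap_eq fun _ => rfl

/-- `colim Gᵢ` as a `Gᵢ`-algebra through the structure map `Gᵢ → colim Gᵢ` (local instance).
[folklore] -/
@[reducible] noncomputable def dlStageAlgebra (i : ι) : Algebra (G i) (DirectLimit G f) :=
  (DirectLimit.Algebra.of G f i).toRingHom.toAlgebra

attribute [local instance] dlStageAlgebra

/-- The structure map `Gᵢ → colim G` is `of i`. [folklore] -/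
theorem dlStage_algebraMap_apply (i : ι) (x : G i) :
    algebraMap (G i) (DirectLimit G f) x = DirectLimit.Algebra.of G f i x := rfl

/-- `A → Gᵢ → colim G`. [folklore] -/
instance dlStage_isScalarTower (i : ι) : IsScalarTower A (G i) (DirectLimit G f) :=
  IsScalarTower.of_algebraMap_eq fun a => ((DirectLimit.Algebra.of G f i).commutes a).symm

/-- `Gⱼ → colim G` (`j ≥ i`) as a `Gᵢ`-algebra map. [folklore] -/
noncomputable def iciStageToDirectLimit (i : ι) (j : {j // i ≤ j}) :
    IciStage f i j →ₐ[G i] DirectLimit G f :=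
  { (DirectLimit.Algebra.of G f j.1).toRingHom with
    commutes' := fun x => DirectLimit.Algebra.of_f j.2 x }

/-- `iciStageToDirectLimit` is `of j`. [folklore] -/
theorem iciStageToDirectLimit_apply (i : ι) (j : {j // i ≤ j}) (x : G j.1) :
    iciStageToDirectLimit f i j x = DirectLimit.Algebra.of G f j.1 x := rfl

/-- `colim_{j ≥ i} Gⱼ → colim G`. [folklore] -/
noncomputable def iciToDirectLimit (i : ι) : IciDirectLimit f i →ₐ[G i] DirectLimit G f :=
  DirectLimit.Algebra.lift (IciStage f i) (iciTransition f i) _ (iciStageToDirectLimit f i)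
    fun _ _ hjk x => DirectLimit.Algebra.of_f (G := G) (f := f) hjk x

/-- `iciToDirectLimit` on the stages. [folklore] -/
theorem iciToDirectLimit_of (i : ι) (j : {j // i ≤ j}) (x : G j.1) :
    iciToDirectLimit f i (DirectLimit.Algebra.of (IciStage f i) (iciTransition f i) j x) =
      DirectLimit.Algebra.of G f j.1 x := rfl

omit [Nonempty ι] in
/-- The structure maps of `colim_{j ≥ i} Gⱼ` do not depend on the chosen bound. [folklore] -/
theorem of_ici_eq (i j : ι) (k k' : {k // i ≤ k}) (hk : j ≤ k.1) (hk' : j ≤ k'.1) (x : G j) :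
    DirectLimit.Algebra.of (IciStage f i) (iciTransition f i) k (f j k.1 hk x) =
      DirectLimit.Algebra.of (IciStage f i) (iciTransition f i) k' (f j k'.1 hk' x) := by
  obtain ⟨l, hkl, hk'l⟩ := exists_ge_ge k k'
  rw [← DirectLimit.Algebra.of_f (G := IciStage f i) (f := iciTransition f i) hkl,
    ← DirectLimit.Algebra.of_f (G := IciStage f i) (f := iciTransition f i) hk'l]
  change DirectLimit.Algebra.of (IciStage f i) (iciTransition f i) l (f k.1 l.1 hkl (f j k.1 hk x)) =
    DirectLimit.Algebra.of (IciStage f i) (iciTransition f i) l (f k'.1 l.1 hk'l (f j k'.1 hk' x))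
  rw [DirectedSystem.map_map' f, DirectedSystem.map_map' f]

omit [Nonempty ι] in
/-- A bound of `i` and `j` in `ι` (chosen). [folklore] -/
noncomputable def iciBound (i j : ι) : {k // i ≤ k} :=
  ⟨(exists_ge_ge i j).choose, (exists_ge_ge i j).choose_spec.1⟩

omit [Nonempty ι] in
/-- `j ≤ iciBound i j`. [folklore] -/
theorem le_iciBound (i j : ι) : j ≤ (iciBound i j).1 := (exists_ge_ge i j).choose_spec.2

/-- `Gⱼ → colim_{k ≥ i} Gₖ` through a bound of `i, j`. [folklore] -/
noncomputable def stageToIci (i j : ι) : G j →ₐ[A] IciDirectLimit f i :=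
  ((DirectLimit.Algebra.of (IciStage f i) (iciTransition f i) (iciBound i j)).restrictScalars A).comp
    (f j (iciBound i j).1 (le_iciBound i j))

omit [Nonempty ι] in
/-- `stageToIci` unfolded. [folklore] -/
theorem stageToIci_apply (i j : ι) (x : G j) :
    stageToIci f i j x = DirectLimit.Algebra.of (IciStage f i) (iciTransition f i) (iciBound i j)
      (f j (iciBound i j).1 (le_iciBound i j) x) := rfl

/-- `colim G → colim_{j ≥ i} Gⱼ`. [folklore] -/
noncomputable def directLimitToIci (i : ι) : DirectLimit G f →ₐ[G i] IciDirectLimit f i where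
  __ := DirectLimit.Algebra.lift G f _ (stageToIci f i) fun j j' hjj' x => by
    rw [stageToIci_apply, stageToIci_apply, DirectedSystem.map_map' f]
    exact of_ici_eq f i j _ _ _ _ x
  commutes' := fun x => by
    change DirectLimit.Algebra.lift G f _ (stageToIci f i) _ (DirectLimit.Algebra.of G f i x) = _
    rw [DirectLimit.Algebra.lift_of, stageToIci_apply,
      of_ici_eq f i i (iciBound i i) ⟨i, le_rfl⟩ (le_iciBound i i) le_rfl x, DirectedSystem.map_self' f,
      DirectLimit.algebraMap_def (f := iciTransition f i) ⟨i, le_rfl⟩]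
    change _ = (⟦⟨⟨i, le_rfl⟩, f i i le_rfl x⟩⟧ : IciDirectLimit f i)
    rw [DirectedSystem.map_self' f]
    rfl

/-- `directLimitToIci` on the stages. [folklore] -/
theorem directLimitToIci_of (i j : ι) (x : G j) :
    directLimitToIci f i (DirectLimit.Algebra.of G f j x) = stageToIci f i j x := rfl

/-- **The cofinal subsystem has the same colimit**: `colim_{j ≥ i} Gⱼ ≅ colim G` as
`Gᵢ`-algebras. [cite: StacksProject, Tag 0032] -/
noncomputable def iciEquiv (i : ι) : IciDirectLimit f i ≃ₐ[G i] DirectLimit G f :=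
  AlgEquiv.ofAlgHom (iciToDirectLimit f i) (directLimitToIci f i)
    (by
      apply AlgHom.coe_ringHom_injective
      refine DirectLimit.Ring.hom_ext _ fun j => RingHom.ext fun x => ?_
      change iciToDirectLimit f i (directLimitToIci f i (DirectLimit.Algebra.of G f j x)) =
        DirectLimit.Algebra.of G f j x
      rw [directLimitToIci_of, stageToIci_apply, iciToDirectLimit_of, DirectLimit.Algebra.of_f])
    (by
      refine DirectLimit.Algebra.hom_ext _ fun j => AlgHom.ext fun (x : IciStage f i j) => ?_
      have h := of_ici_eq f i j.1 (iciBound i j.1) j (le_iciBound i j.1) le_rfl (show G j.1 from x)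
      rw [DirectedSystem.map_self' f] at h
      simp only [AlgHom.comp_apply, AlgHom.id_apply]
      exact h)

/-- `iciEquiv.symm` on the stages. [folklore] -/
theorem iciEquiv_symm_of (i j : ι) (x : G j) :
    (iciEquiv f i).symm (DirectLimit.Algebra.of G f j x) = stageToIci f i j x := rfl

end Ici

/-! ### An étale algebra over a directed colimit of étale algebras -/

section EtaleOverDirectLimit

variable {A : Type u} [CommRing A] {ι : Type u} [Preorder ι] [Nonempty ι] [IsDirectedOrder ι]
  {G : ι → Type u} [∀ i, CommRing (G i)] [∀ i, Algebra A (G i)]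
  (f : ∀ i j, i ≤ j → G i →ₐ[A] G j) [DirectedSystem G (f · · ·)]

attribute [local instance] dlStageAlgebra

set_option maxHeartbeats 1600000 in
/-- **An étale algebra over a directed colimit of étale algebras satisfies the factorization
criterion** (it is again ind-étale): an étale `E` over `B = colim Gᵢ` has a Noetherian model
`E ≅ B ⊗_{A₀} E₀` over a finitely generated subring `A₀ ⊆ B` (Mathlib
`Algebra.Etale.exists_subalgebra_fg`, Tag 00U2 (8)); `A₀ → B` factors through some `Gᵢ`, so
`E ≅ B ⊗_{Gᵢ} Eᵢ` with `Eᵢ = Gᵢ ⊗_{A₀} E₀` étale over `A`, and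
`B ⊗_{Gᵢ} Eᵢ ≅ colim_{j ≥ i} (Eᵢ ⊗_{Gᵢ} Gⱼ)` is a directed colimit of étale `A`-algebras.
[cite: StacksProject, Tag 0BSI] -/
theorem FactorsEtale.of_etale_over_directLimit [∀ i, Algebra.Etale A (G i)]
    (E : Type u) [CommRing E] [Algebra (DirectLimit G f) E] [Algebra A E]
    [IsScalarTower A (DirectLimit G f) E] [Algebra.Etale (DirectLimit G f) E] :
    FactorsEtale A E := by
  classical
  -- Noetherian model over a finitely generated `ℤ`-subalgebra `A₀ ⊆ colim G`
  obtain ⟨A₀, E₀, _, _, hA₀, hE₀, ⟨e⟩⟩ :=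
    Algebra.Etale.exists_subalgebra_fg (R := ℤ) (A := DirectLimit G f) (B := E)
  have hFT : Algebra.FiniteType ℤ A₀ := ⟨(Subalgebra.fg_top A₀).mpr hA₀⟩
  have hpres : ∃ (n : ℕ) (π : MvPolynomial (Fin n) ℤ →+* A₀),
      Function.Surjective π ∧ (RingHom.ker π).FG := by
    obtain ⟨n, π, hπ⟩ := Algebra.FiniteType.iff_quotient_mvPolynomial''.1 hFT
    exact ⟨n, π.toRingHom, hπ, (isNoetherianRing_iff_ideal_fg _).1 inferInstance _⟩
  -- `A₀ → colim G` factors through some `Gᵢ`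
  obtain ⟨i, φ₀, hφ₀⟩ :=
    exists_ringHom_factor_of_finitePresentation f A₀ hpres (algebraMap A₀ (DirectLimit G f))
  letI : Algebra A₀ (G i) := φ₀.toAlgebra
  haveI : IsScalarTower A₀ (G i) (DirectLimit G f) :=
    IsScalarTower.of_algebraMap_eq fun a => (hφ₀ a).symm
  -- the étale `Gᵢ`-algebra `Eᵢ = Gᵢ ⊗_{A₀} E₀`, étale over `A`
  haveI : SMulCommClass A₀ A (G i) :=
    ⟨fun a b x => by simp only [Algebra.smul_def, ← mul_assoc, mul_comm (algebraMap A₀ (G i) a)]⟩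
  let Ei : Type u := G i ⊗[A₀] E₀
  haveI : Algebra.Etale A Ei := Algebra.Etale.comp A (G i) Ei
  -- the target: `colim_{j ≥ i} (Eᵢ ⊗_{Gᵢ} Gⱼ)`
  let T : Type u := BaseChangeDirectLimit (iciTransition f i) Ei
  letI : Algebra A T := ((algebraMap Ei T).comp (algebraMap A Ei)).toAlgebra
  haveI : IsScalarTower A Ei T := IsScalarTower.of_algebraMap_eq fun _ => rfl
  have hT : FactorsEtale A T :=
    FactorsEtale.of_etale_left Ei
      (FactorsEtale.directLimit_of_etale (bcTransition (iciTransition f i) Ei))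
  -- the ring isomorphism `E ≅ T`
  let e1 := Algebra.TensorProduct.cancelBaseChange A₀ (G i) (DirectLimit G f) (DirectLimit G f) E₀
  let e2 := Algebra.TensorProduct.comm (G i) (DirectLimit G f) Ei
  let e3 : Ei ⊗[G i] DirectLimit G f ≃ₐ[Ei] Ei ⊗[G i] IciDirectLimit f i :=
    Algebra.TensorProduct.congr (AlgEquiv.refl : Ei ≃ₐ[Ei] Ei) (iciEquiv f i).symm
  let e4 := baseChangeDirectLimitEquiv (iciTransition f i) Ei
  let eR : E ≃+* T :=
    e.toRingEquiv.trans (e1.symm.toRingEquiv.trans (e2.toRingEquiv.trans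
      (e3.toRingEquiv.trans e4.toRingEquiv)))
  have hcomm : ∀ a : A, eR (algebraMap A E a) = algebraMap A T a := by
    intro a
    set k : {k // i ≤ k} := iciBound i i
    have hb : algebraMap A (DirectLimit G f) a =
        DirectLimit.Algebra.of G f i (algebraMap A (G i) a) :=
      ((DirectLimit.Algebra.of G f i).commutes a).symm
    -- through `e`
    have s0 : e (algebraMap A E a) = algebraMap A (DirectLimit G f) a ⊗ₜ (1 : E₀) := by
      rw [IsScalarTower.algebraMap_apply A (DirectLimit G f) E, e.commutes,
        Algebra.TensorProduct.algebraMap_apply, Algebra.algebraMap_self, RingHom.id_apply]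
    have s1 : e1.symm (algebraMap A (DirectLimit G f) a ⊗ₜ (1 : E₀)) =
        algebraMap A (DirectLimit G f) a ⊗ₜ (1 : Ei) := by
      rw [Algebra.TensorProduct.cancelBaseChange_symm_tmul]
      rfl
    have s2 : e2 (algebraMap A (DirectLimit G f) a ⊗ₜ (1 : Ei)) =
        (1 : Ei) ⊗ₜ algebraMap A (DirectLimit G f) a :=
      Algebra.TensorProduct.comm_tmul _ _ _
    have s3 : e3 ((1 : Ei) ⊗ₜ algebraMap A (DirectLimit G f) a) =
        (1 : Ei) ⊗ₜ DirectLimit.Algebra.of (IciStage f i) (iciTransition f i) k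
          (f i k.1 (le_iciBound i i) (algebraMap A (G i) a)) := by
      rw [Algebra.TensorProduct.congr_apply, Algebra.TensorProduct.map_tmul, hb]
      rfl
    have s4 : e4 ((1 : Ei) ⊗ₜ DirectLimit.Algebra.of (IciStage f i) (iciTransition f i) k
          (f i k.1 (le_iciBound i i) (algebraMap A (G i) a))) =
        DirectLimit.Algebra.of _ (bcTransition (iciTransition f i) Ei) k
          ((1 : Ei) ⊗ₜ[G i] (f i k.1 (le_iciBound i i) (algebraMap A (G i) a) : IciStage f i k)) :=
      baseChangeDirectLimitEquiv_tmul _ _ _ _ _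
    have lhs : eR (algebraMap A E a) = DirectLimit.Algebra.of _ (bcTransition (iciTransition f i) Ei) k
          ((1 : Ei) ⊗ₜ[G i] (f i k.1 (le_iciBound i i) (algebraMap A (G i) a) : IciStage f i k)) := by
      change e4 (e3 (e2 (e1.symm (e (algebraMap A E a))))) = _
      rw [s0, s1, s2, s3, s4]
    rw [lhs]
    -- the right-hand side
    have r1 : algebraMap A T a = algebraMap Ei T (algebraMap A Ei a) := rfl
    rw [r1, DirectLimit.algebraMap_def (G := fun j => Ei ⊗[G i] IciStage f i j)
        (f := bcTransition (iciTransition f i) Ei) k,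
      ← DirectLimit.Algebra.of_apply (G := fun j => Ei ⊗[G i] IciStage f i j)
        (f := bcTransition (iciTransition f i) Ei)]
    congr 1
    rw [← IsScalarTower.algebraMap_apply A Ei (Ei ⊗[G i] IciStage f i k),
      IsScalarTower.algebraMap_apply A (G i) (Ei ⊗[G i] IciStage f i k),
      Algebra.TensorProduct.algebraMap_apply' (R := G i)]
    rfl
  let eA : E ≃ₐ[A] T := AlgEquiv.ofRingEquiv (f := eR) hcomm
  exact hT.of_equiv eA.symm

/-- **Transitivity with an explicitly presented ind-étale middle term**: if `C` satisfies the
factorization criterion over a directed colimit `B = colim Gᵢ` of étale `A`-algebras, then `C`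
satisfies it over `A` (base-change the finitely presented `A`-algebra to `B`, factor through an
étale `B`-algebra, which is ind-étale over `A` by `of_etale_over_directLimit`).
[cite: StacksProject, Tag 097K] -/
theorem FactorsEtale.trans_directLimit [∀ i, Algebra.Etale A (G i)]
    (C : Type u) [CommRing C] [Algebra (DirectLimit G f) C] [Algebra A C]
    [IsScalarTower A (DirectLimit G f) C] (h : FactorsEtale (DirectLimit G f) C) :
    FactorsEtale A C := by
  intro P _ _ _ φ
  let φ' : DirectLimit G f ⊗[A] P →ₐ[DirectLimit G f] C :=
    Algebra.TensorProduct.lift (Algebra.ofId _ C) φ (fun _ _ => Commute.all _ _)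
  obtain ⟨E, _, _, _, α, β, hαβ⟩ := h (DirectLimit G f ⊗[A] P) φ'
  letI : Algebra A E := ((algebraMap (DirectLimit G f) E).comp (algebraMap A _)).toAlgebra
  haveI : IsScalarTower A (DirectLimit G f) E := IsScalarTower.of_algebraMap_eq (fun _ => rfl)
  have hE : FactorsEtale A E := FactorsEtale.of_etale_over_directLimit f E
  obtain ⟨B', _, _, _, α', β', hαβ'⟩ :=
    hE P ((α.restrictScalars A).comp Algebra.TensorProduct.includeRight)
  refine ⟨B', inferInstance, inferInstance, inferInstance, α', (β.restrictScalars A).comp β', ?_⟩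
  rw [AlgHom.comp_assoc, hαβ']
  ext p
  have := congrArg (fun ψ : DirectLimit G f ⊗[A] P →ₐ[DirectLimit G f] C => ψ (1 ⊗ₜ p)) hαβ
  simpa [φ'] using this

end EtaleOverDirectLimit

end Literature.RingTheory.Etale
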